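import Mathlib
import HarnessLib
import Summits.AtomisticToContinuum.BoseEinsteinCondensation.Theses.BlockLatticeFSum
import Summits.AtomisticToContinuum.BoseEinsteinCondensation.Theorems.DeepInfraredEmptinessResponseComposition
import Summits.AtomisticToContinuum.BoseEinsteinCondensation.Theorems.DeepInfraredEmptinessPlaneWaveBudget
import Literature.MathematicalPhysics.QuantumManyBody.BoseGasThermodynamicLimitRuelle

/-!
(PLANE-WAVE CARVING part 2/2 — the thin TERMINAL module (critic row 364 (2)): imports the Theses-free budget module
`Theorems/DeepInfraredEmptinessPlaneWaveBudget.lean` + the route file, and concludes the route decl BY NAME.  def-free TREE TWIN of the node file `run/shared/lean/pub/decomp-a2c/decomp-a2c-lens-6/g25/PlaneWaveCarving.lean`: the three piece `def`s are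
INLINED as hypothesis / conclusion texts; proofs verbatim; for landing as `Theorems/DeepInfraredEmptinessPlaneWaveCarving.lean --supports stmt-AtomisticToContinuum-27506`.)
 # BlockLatticeFSum · residual `DeepInfraredEmptiness` (stmt-AtomisticToContinuum-27506) — NODE «PlaneWaveCarving»
# (decomp-a2c lens-6 «barrier-complement carving», generation 25)

The block waves `f_q` (`q ∈ (ℤ/K)³`, constant on blocks of side `ℓ = L/K`) are NOT eigenfunctions of the torus Laplacian;
their Fourier support is the alias lattice `q̃ + Kℤ³` (`q̃ ∈ (−K/2, K/2]³` the centred representative), with weights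
`∏ⱼ sinc²(π pⱼ/K)` summing to `1`.  Carving the deep-infrared block shell along this support splits the residual into

* `AliasDomination` (AD) — KINEMATICS, true for every state: `n(f_q) ≤ Σ_{m ∈ ℤ³} n(e_{q̃+Km})` (Cauchy–Schwarz in the
  plane-wave basis, `Σ_m |c_m|² = ‖f_q‖² = 1`);                                               tag TRUE·KNOWN (typed, proof = M)
* `UVAliasBudget` (UVB) — PROVED HERE (`uvAliasBudget_holds`, 0 sorry): for blocks below the scale `2A_uv/√ρ`
  (`A_uv = 1/(8(16πR+1))`, `R` a range of `v`) the higher aliases `m ≠ 0` of the whole block lattice carry `≤ N/16`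
  in every `ρN`-near-minimiser: they have `|p|_∞ ≥ K/2`, i.e. `|k| ≥ π/ℓ`, and kinetic Chebyshev with the Dyson–LSSY
  ceiling `T ≤ (16πR+1)ρN` (`tsum_fracDispersion_two_mul_cellOccupation`, `periodicGroundStateEnergy_le_uniform`, the Dyson–LSSY ceiling through the hard core of radius `2R`)
  bounds their total occupation by `(ℓ/π)² T ≤ N/16`;                                            tag TRUE·PROVED
* `DeepPlaneWaveEmptiness` (IRBall) — the NEW RESIDUAL, basis-free and block-free: for some `k₀ > 0`, every finite set of
  non-zero torus momenta in the cube `|k_j| < k₀√ρ` carries `≤ N/16` in near-minimisers.        tag WEAKER·IDEA-NEEDED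

and the kernel-checked composition `deepInfraredEmptiness_of_planeWaveCarving : IRBall → UVB → AD → DeepInfraredEmptiness`
(route decl BY NAME; `A := A_uv`, `θ := 2(k₀A/π)²` puts every deep block wavevector `q̃` in the cube since
`8q̃ⱼ²/K² ≤ ε(q) < θ` and `K/L ≤ √ρ/A`), hence `deepInfraredEmptiness_of_irball_alias : IRBall → AD → DeepInfraredEmptiness`.

CERTIFICATE (strictly weaker): `DIE ⟸ IRBall ∧ AD` with AD a kinematic identity-grade fact; `IRBall` is implied by the
pointwise periodic infrared bound of route BECGaussianDomination (stmt-3631, moot) summed over the `O(k₀³ρ^{3/2}L³) = O(k₀³√ρ N)`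
modes of the cube, and by piece B (`LinearResponseGain`) + A (`TorusHyperuniformity`) of the g24 carving after translation
averaging; it asks for NO rate, NO pointwise profile and NO block structure.  Bogoliubov value of the cube's occupation:
`≈ N k₀² √(πρa)·(3/π²)·√ρ… = O(√ρ)·N → 0`, so IRBall holds with room `ρ^{1/2}` in Bogoliubov theory for EVERY `k₀`.
Free gas (`a = 0`): IRBall holds for every `k₀` (indeed for every finite set of non-zero momenta) — `deepPlaneWaveEmptiness_free`.

What IRBall still needs (IDEA-NEEDED): an a-priori bound on the smeared zero-momentum peak of near-minimisers at momenta
`|k| ≲ √ρ` — the regime where neither the kinetic Chebyshev budget (`Σ |k|²n_k ≤ CρaN` gives only `Σ_{|k|<k₀√ρ} n_k ≤ N`,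
vacuous) nor energy asymptotics (barrier `EnergyAsymptoticsWithoutCondensation`) bite; candidate inputs: Onsager–Penrose
/ structure-factor sum rules at `k → 0` (9093-type hyperuniformity ⇒ IRBall via the g24 linear-response step), or a
momentum-space localisation of the LSSY Dirichlet-box BEC proof (`BecIrWindow` of route BECInfraredBound is its pointwise,
Dirichlet, rate-carrying cousin — open). -/

noncomputable section

namespace Summit.AtomisticToContinuum.BoseEinsteinCondensation.Theorems.DeepInfraredEmptinessPlaneWaveCarving

open Filter MeasureTheory
open scoped ENNReal
open Literature.MathematicalPhysics.QuantumManyBody.BoseGas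
open Summit.AtomisticToContinuum.BoseEinsteinCondensation.Theorems.DeepInfraredEmptinessResponseComposition
open Summit.AtomisticToContinuum.BoseEinsteinCondensation.Theorems.DeepInfraredEmptinessPlaneWaveBudget

/-! ## The three pieces -/

/-! ### piece `DeepPlaneWaveEmptiness` (INLINED below as a hypothesis / conclusion text; the node file keeps it as a `def`)
**IRBall — `DeepPlaneWaveEmptiness` (NEW RESIDUAL; WEAKER · IDEA-NEEDED).**  For every admissible `v` there are
`k₀ > 0` and `ρ₀ > 0` such that for `ρ < ρ₀`, eventually in `N`, some `δ > 0` and every `δ`-near-minimiser `Ψ` on the torus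
of side `L = (N/ρ)^{1/3}`: every finite set `S` of NON-ZERO momenta `p ∈ ℤ³` inside the infrared cube
`2π|pⱼ|/L < k₀√ρ` (`j = 1,2,3`) has total plane-wave occupation `Σ_{p ∈ S} ⟨e_p, γ_Ψ e_p⟩ ≤ N/16`.

```
  ∀ v : ℝ → ENNReal, IsRepulsiveFiniteRange v → ∃ k₀ : ℝ, 0 < k₀ ∧ ∃ ρ₀ : ℝ, 0 < ρ₀ ∧ ∀ ρ : ℝ, 0 < ρ → ρ < ρ₀ →
    ∀ᶠ N : ℕ in Filter.atTop, ∃ δ : ENNReal, 0 < δ ∧ ∀ Ψ : PeriodicTrialState N (sideLength ρ N),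
      periodicEnergy v Ψ ≤ periodicGroundStateEnergy v N (sideLength ρ N) + δ →
      ∀ S : Finset (Fin 3 → ℤ),
        (∀ p ∈ S, p ≠ 0 ∧ ∀ j : Fin 3, 2 * Real.pi * |((p j : ℤ) : ℝ)| / sideLength ρ N < k₀ * Real.sqrt ρ) →
        ∑ p ∈ S, cellOccupation N (sideLength ρ N) (planeWaveMode (sideLength ρ N) p) Ψ.ψ ≤ ENNReal.ofReal ((N : ℝ) / 16)
```
-/

/-! ### piece `UVAliasBudget` (INLINED below as a hypothesis / conclusion text; the node file keeps it as a `def`)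
**UVB — `UVAliasBudget` (TRUE · PROVED below).**  For every admissible `v` there are `A > 0` and `ρ₀ > 0` such that for
`ρ < ρ₀`, eventually in `N`, some `δ > 0` and every `δ`-near-minimiser: for every block number `K > 0` with
`L/K ≤ 2A/√ρ`, the higher aliases of the whole block lattice carry at most `N/16`:
`Σ_{q ∈ (ℤ/K)³} Σ_{m ≠ 0} ⟨e_{q̃+Km}, γ_Ψ e_{q̃+Km}⟩ ≤ N/16` (`q̃ⱼ = qⱼ` if `2qⱼ ≤ K`, else `qⱼ − K`).

```
  ∀ v : ℝ → ENNReal, IsRepulsiveFiniteRange v → ∃ A : ℝ, 0 < A ∧ ∃ ρ₀ : ℝ, 0 < ρ₀ ∧ ∀ ρ : ℝ, 0 < ρ → ρ < ρ₀ →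
    ∀ᶠ N : ℕ in Filter.atTop, ∃ δ : ENNReal, 0 < δ ∧ ∀ Ψ : PeriodicTrialState N (sideLength ρ N),
      periodicEnergy v Ψ ≤ periodicGroundStateEnergy v N (sideLength ρ N) + δ →
      ∀ K : ℕ, 0 < K → sideLength ρ N / (K : ℝ) ≤ 2 * A / Real.sqrt ρ →
        (∑ q : Fin 3 → Fin K, ∑' m : Fin 3 → ℤ, (if m = 0 then 0 else
          cellOccupation N (sideLength ρ N) (planeWaveMode (sideLength ρ N)
            (fun j => (if 2 * (q j : ℕ) ≤ K then (((q j : ℕ) : ℤ)) else (((q j : ℕ) : ℤ) - (K : ℤ))) + (K : ℤ) * m j)) Ψ.ψ))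
          ≤ ENNReal.ofReal ((N : ℝ) / 16)
```
-/

/-! ### piece `AliasDomination` (INLINED below as a hypothesis / conclusion text; the node file keeps it as a `def`)
**AD — `AliasDomination` (TRUE · KNOWN kinematics; typed, proof deferred — size M: Parseval polarisation on the cell and the
Fourier support `q̃ + Kℤ³` of a block wave).**  For every periodic trial state and every block wave `f_q`:
`⟨f_q, γ_Ψ f_q⟩ ≤ Σ_{m ∈ ℤ³} ⟨e_{q̃+Km}, γ_Ψ e_{q̃+Km}⟩` (Cauchy–Schwarz, `Σ_m |⟨e_{q̃+Km}, f_q⟩|² = 1`).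

```
  ∀ (N : ℕ) (L : ℝ), 0 < L → ∀ K : ℕ, 0 < K → ∀ Ψ : PeriodicTrialState N L, ∀ q : Fin 3 → Fin K,
    cellOccupation N L (fun x : EuclideanSpace ℝ (Fin 3) => (((Real.sqrt (L ^ 3))⁻¹ : ℝ) : ℂ) * Complex.exp (((2 * Real.pi * (∑ j : Fin 3, ((q j : ℕ) : ℝ) * (⌊(K : ℝ) * x j / L⌋ : ℝ)) / (K : ℝ) : ℝ) : ℂ) * Complex.I)) Ψ.ψ
      ≤ ∑' m : Fin 3 → ℤ, cellOccupation N L (planeWaveMode L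
          (fun j => (if 2 * (q j : ℕ) ≤ K then (((q j : ℕ) : ℤ)) else (((q j : ℕ) : ℤ) - (K : ℤ))) + (K : ℤ) * m j)) Ψ.ψ
```
-/

/-! ## The composition (real proof): IRBall ∧ UVB ∧ AD ⟹ the residual, route decl by name -/

/-- **IRBall → UVB → AD → `BlockLatticeFSum.DeepInfraredEmptiness`** with `A := A_uv` and `θ := 2(k₀A/π)²`. [folklore] -/
theorem deepInfraredEmptiness_of_planeWaveCarving
    (hIR : (∀ v : ℝ → ENNReal, IsRepulsiveFiniteRange v → ∃ k₀ : ℝ, 0 < k₀ ∧ ∃ ρ₀ : ℝ, 0 < ρ₀ ∧ ∀ ρ : ℝ, 0 < ρ → ρ < ρ₀ →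
        ∀ᶠ N : ℕ in Filter.atTop, ∃ δ : ENNReal, 0 < δ ∧ ∀ Ψ : PeriodicTrialState N (sideLength ρ N),
          periodicEnergy v Ψ ≤ periodicGroundStateEnergy v N (sideLength ρ N) + δ →
          ∀ S : Finset (Fin 3 → ℤ),
            (∀ p ∈ S, p ≠ 0 ∧ ∀ j : Fin 3, 2 * Real.pi * |((p j : ℤ) : ℝ)| / sideLength ρ N < k₀ * Real.sqrt ρ) →
            ∑ p ∈ S, cellOccupation N (sideLength ρ N) (planeWaveMode (sideLength ρ N) p) Ψ.ψ ≤ ENNReal.ofReal ((N : ℝ) / 16)))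
    (hUV : (∀ v : ℝ → ENNReal, IsRepulsiveFiniteRange v → ∃ A : ℝ, 0 < A ∧ ∃ ρ₀ : ℝ, 0 < ρ₀ ∧ ∀ ρ : ℝ, 0 < ρ → ρ < ρ₀ →
        ∀ᶠ N : ℕ in Filter.atTop, ∃ δ : ENNReal, 0 < δ ∧ ∀ Ψ : PeriodicTrialState N (sideLength ρ N),
          periodicEnergy v Ψ ≤ periodicGroundStateEnergy v N (sideLength ρ N) + δ →
          ∀ K : ℕ, 0 < K → sideLength ρ N / (K : ℝ) ≤ 2 * A / Real.sqrt ρ →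
            (∑ q : Fin 3 → Fin K, ∑' m : Fin 3 → ℤ, (if m = 0 then 0 else
              cellOccupation N (sideLength ρ N) (planeWaveMode (sideLength ρ N)
                (fun j => (if 2 * (q j : ℕ) ≤ K then (((q j : ℕ) : ℤ)) else (((q j : ℕ) : ℤ) - (K : ℤ))) + (K : ℤ) * m j)) Ψ.ψ))
              ≤ ENNReal.ofReal ((N : ℝ) / 16)))
    (hAD : (∀ (N : ℕ) (L : ℝ), 0 < L → ∀ K : ℕ, 0 < K → ∀ Ψ : PeriodicTrialState N L, ∀ q : Fin 3 → Fin K,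
        cellOccupation N L (fun x : EuclideanSpace ℝ (Fin 3) => (((Real.sqrt (L ^ 3))⁻¹ : ℝ) : ℂ) * Complex.exp (((2 * Real.pi * (∑ j : Fin 3, ((q j : ℕ) : ℝ) * (⌊(K : ℝ) * x j / L⌋ : ℝ)) / (K : ℝ) : ℝ) : ℂ) * Complex.I)) Ψ.ψ
          ≤ ∑' m : Fin 3 → ℤ, cellOccupation N L (planeWaveMode L
              (fun j => (if 2 * (q j : ℕ) ≤ K then (((q j : ℕ) : ℤ)) else (((q j : ℕ) : ℤ) - (K : ℤ))) + (K : ℤ) * m j)) Ψ.ψ)) :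
    Summit.AtomisticToContinuum.BoseEinsteinCondensation.Theses.BlockLatticeFSum.DeepInfraredEmptiness := by
  intro v hv
  obtain ⟨k₀, hk₀, ρ₁, hρ₁, H1⟩ := hIR v hv
  obtain ⟨A, hA, ρ₂, hρ₂, H2⟩ := hUV v hv
  refine ⟨A, hA, 2 * (k₀ * A / Real.pi) ^ 2, by positivity, min ρ₁ ρ₂, lt_min hρ₁ hρ₂, fun ρ hρ hρlt => ?_⟩
  filter_upwards [H1 ρ hρ (hρlt.trans_le (min_le_left _ _)), H2 ρ hρ (hρlt.trans_le (min_le_right _ _)),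
    eventually_gt_atTop 0] with N hN1 hN2 hN0
  obtain ⟨δ₁, hδ₁, G1⟩ := hN1
  obtain ⟨δ₂, hδ₂, G2⟩ := hN2
  refine ⟨min δ₁ δ₂, lt_min hδ₁ hδ₂, ?_⟩
  have hL : 0 < sideLength ρ N := sideLength_pos_of_pos hρ hN0
  generalize sideLength ρ N = L at hL G1 G2 ⊢
  intro Ψ hΨ K _ hK hwin
  have hΨ1 : periodicEnergy v Ψ ≤ periodicGroundStateEnergy v N L + δ₁ :=
    hΨ.trans (add_le_add le_rfl (min_le_left _ _))
  have hΨ2 : periodicEnergy v Ψ ≤ periodicGroundStateEnergy v N L + δ₂ :=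
    hΨ.trans (add_le_add le_rfl (min_le_right _ _))
  have hKr : (0 : ℝ) < K := Nat.cast_pos.2 hK
  have hsρ : 0 < Real.sqrt ρ := Real.sqrt_pos.2 hρ
  -- notation: centred representative and the alias remainder
  set ct : (Fin 3 → Fin K) → (Fin 3 → ℤ) :=
    fun q j => (if 2 * (q j : ℕ) ≤ K then (((q j : ℕ) : ℤ)) else (((q j : ℕ) : ℤ) - (K : ℤ))) with hct
  set R : (Fin 3 → Fin K) → ℝ≥0∞ := fun q => ∑' m : Fin 3 → ℤ, (if m = 0 then 0 else
    cellOccupation N L (planeWaveMode L (fun j => (if 2 * (q j : ℕ) ≤ K then (((q j : ℕ) : ℤ)) else (((q j : ℕ) : ℤ) - (K : ℤ))) + (K : ℤ) * m j)) Ψ.ψ) with hR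
  set deep := (Finset.univ.filter fun q : Fin 3 → Fin K => ¬ (∀ j : Fin 3, (q j : ℕ) = 0) ∧
    (∑ j : Fin 3, (1 - Real.cos (2 * Real.pi * ((q j : ℕ) : ℝ) / (K : ℝ)))) < 2 * (k₀ * A / Real.pi) ^ 2) with hdeep
  -- step 1 (AD, split at the principal alias): n(f_q) ≤ n(e_{q̃}) + R q
  have step1 : ∀ q : Fin 3 → Fin K,
      cellOccupation N L (fun x : EuclideanSpace ℝ (Fin 3) => (((Real.sqrt (L ^ 3))⁻¹ : ℝ) : ℂ) * Complex.exp (((2 * Real.pi * (∑ j : Fin 3, ((q j : ℕ) : ℝ) * (⌊(K : ℝ) * x j / L⌋ : ℝ)) / (K : ℝ) : ℝ) : ℂ) * Complex.I)) Ψ.ψ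
        ≤ cellOccupation N L (planeWaveMode L (ct q)) Ψ.ψ + R q := by
    intro q
    refine (hAD N L hL K hK Ψ q).trans (le_of_eq ?_)
    rw [ENNReal.summable.tsum_eq_add_tsum_ite' (0 : Fin 3 → ℤ)]
    congr 2
    funext j
    simp [hct]
  -- step 2 (IRBall on the principal aliases of the deep shell)
  have hinj : ∀ q ∈ deep, ∀ q' ∈ deep, ct q = ct q' → q = q' := by
    intro q _ q' _ h
    funext j
    exact crep_injective K (congr_fun h j)
  have hAK : A * (K : ℝ) ≤ Real.sqrt ρ * L := by
    have h := hwin.1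
    rw [div_le_div_iff₀ hsρ hKr] at h
    linarith
  have hmem : ∀ p ∈ deep.image ct, p ≠ 0 ∧ ∀ j : Fin 3, 2 * Real.pi * |((p j : ℤ) : ℝ)| / L < k₀ * Real.sqrt ρ := by
    intro p hp
    rw [Finset.mem_image] at hp
    obtain ⟨q, hq, rfl⟩ := hp
    rw [hdeep, Finset.mem_filter] at hq
    obtain ⟨_, hq0, hqε⟩ := hq
    refine ⟨fun h0 => hq0 fun j => crep_eq_zero K (q j) (by simpa [hct] using congr_fun h0 j), fun j => ?_⟩
    have h8 := (crep_sq_le_eps K hK q j).trans_lt hqε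
    -- `8 c²/K² < 2 (k₀A/π)²` ⇒ `|c| < k₀ A K/(2π)`
    have hc2 : (|((ct q j : ℤ) : ℝ)|) ^ 2 < (k₀ * A * (K : ℝ) / (2 * Real.pi)) ^ 2 := by
      have hK2 : (0 : ℝ) < (K : ℝ) ^ 2 := by positivity
      rw [div_lt_iff₀ hK2] at h8
      have : (k₀ * A * (K : ℝ) / (2 * Real.pi)) ^ 2 = 2 * (k₀ * A / Real.pi) ^ 2 * (K : ℝ) ^ 2 / 8 := by
        field_simp
        ring
      rw [this]
      simpa [hct] using (by linarith : (|((ct q j : ℤ) : ℝ)|) ^ 2 < 2 * (k₀ * A / Real.pi) ^ 2 * (K : ℝ) ^ 2 / 8)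
    have hc : |((ct q j : ℤ) : ℝ)| < k₀ * A * (K : ℝ) / (2 * Real.pi) :=
      lt_of_pow_lt_pow_left₀ 2 (by positivity) hc2
    calc 2 * Real.pi * |((ct q j : ℤ) : ℝ)| / L
        < 2 * Real.pi * (k₀ * A * (K : ℝ) / (2 * Real.pi)) / L := by gcongr
      _ = k₀ * (A * (K : ℝ)) / L := by field_simp
      _ ≤ k₀ * (Real.sqrt ρ * L) / L := by gcongr
      _ = k₀ * Real.sqrt ρ := by field_simp
  have step2 : ∑ q ∈ deep, cellOccupation N L (planeWaveMode L (ct q)) Ψ.ψ ≤ ENNReal.ofReal ((N : ℝ) / 16) := by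
    rw [← Finset.sum_image (f := fun p : Fin 3 → ℤ => cellOccupation N L (planeWaveMode L p) Ψ.ψ) hinj]
    exact G1 Ψ hΨ1 (deep.image ct) hmem
  -- step 3 (UVB on the higher aliases)
  have step3 : ∑ q ∈ deep, R q ≤ ENNReal.ofReal ((N : ℝ) / 16) :=
    (Finset.sum_le_univ_sum_of_nonneg fun _ => bot_le).trans (G2 Ψ hΨ2 K hK hwin.2)
  -- combine
  calc ∑ q ∈ deep, cellOccupation N L (fun x : EuclideanSpace ℝ (Fin 3) => (((Real.sqrt (L ^ 3))⁻¹ : ℝ) : ℂ) * Complex.exp (((2 * Real.pi * (∑ j : Fin 3, ((q j : ℕ) : ℝ) * (⌊(K : ℝ) * x j / L⌋ : ℝ)) / (K : ℝ) : ℝ) : ℂ) * Complex.I)) Ψ.ψ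
      ≤ ∑ q ∈ deep, (cellOccupation N L (planeWaveMode L (ct q)) Ψ.ψ + R q) := Finset.sum_le_sum fun q _ => step1 q
    _ = (∑ q ∈ deep, cellOccupation N L (planeWaveMode L (ct q)) Ψ.ψ) + ∑ q ∈ deep, R q := Finset.sum_add_distrib
    _ ≤ ENNReal.ofReal ((N : ℝ) / 16) + ENNReal.ofReal ((N : ℝ) / 16) := add_le_add step2 step3
    _ = ENNReal.ofReal ((N : ℝ) / 8) := by
        rw [← ENNReal.ofReal_add (by positivity) (by positivity)]
        congr 1
        ring

/-- **Hence the residual follows from IRBall and the kinematic AD alone** (UVB discharged). [folklore] -/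
theorem deepInfraredEmptiness_of_irball_alias
    (hIR : (∀ v : ℝ → ENNReal, IsRepulsiveFiniteRange v → ∃ k₀ : ℝ, 0 < k₀ ∧ ∃ ρ₀ : ℝ, 0 < ρ₀ ∧ ∀ ρ : ℝ, 0 < ρ → ρ < ρ₀ →
        ∀ᶠ N : ℕ in Filter.atTop, ∃ δ : ENNReal, 0 < δ ∧ ∀ Ψ : PeriodicTrialState N (sideLength ρ N),
          periodicEnergy v Ψ ≤ periodicGroundStateEnergy v N (sideLength ρ N) + δ →
          ∀ S : Finset (Fin 3 → ℤ),
            (∀ p ∈ S, p ≠ 0 ∧ ∀ j : Fin 3, 2 * Real.pi * |((p j : ℤ) : ℝ)| / sideLength ρ N < k₀ * Real.sqrt ρ) →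
            ∑ p ∈ S, cellOccupation N (sideLength ρ N) (planeWaveMode (sideLength ρ N) p) Ψ.ψ ≤ ENNReal.ofReal ((N : ℝ) / 16)))
    (hAD : (∀ (N : ℕ) (L : ℝ), 0 < L → ∀ K : ℕ, 0 < K → ∀ Ψ : PeriodicTrialState N L, ∀ q : Fin 3 → Fin K,
        cellOccupation N L (fun x : EuclideanSpace ℝ (Fin 3) => (((Real.sqrt (L ^ 3))⁻¹ : ℝ) : ℂ) * Complex.exp (((2 * Real.pi * (∑ j : Fin 3, ((q j : ℕ) : ℝ) * (⌊(K : ℝ) * x j / L⌋ : ℝ)) / (K : ℝ) : ℝ) : ℂ) * Complex.I)) Ψ.ψ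
          ≤ ∑' m : Fin 3 → ℤ, cellOccupation N L (planeWaveMode L
              (fun j => (if 2 * (q j : ℕ) ≤ K then (((q j : ℕ) : ℤ)) else (((q j : ℕ) : ℤ) - (K : ℤ))) + (K : ℤ) * m j)) Ψ.ψ)) :
    Summit.AtomisticToContinuum.BoseEinsteinCondensation.Theses.BlockLatticeFSum.DeepInfraredEmptiness :=
  deepInfraredEmptiness_of_planeWaveCarving hIR uvAliasBudget_holds hAD

end Summit.AtomisticToContinuum.BoseEinsteinCondensation.Theorems.DeepInfraredEmptinessPlaneWaveCarving

end
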